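import Literature.Analysis.SpecialFunctions.RiemannThetaBlockDiagonalSingular
import Literature.Analysis.SpecialFunctions.RiemannThetaLefschetz
import Mathlib.LinearAlgebra.Matrix.Rank
import HarnessLib

/-!
# The Hessian of `ϑ(·, Ω₁ ⊕ Ω₂)` on `Θ₁ × Θ₂`: the tangent cone is the union of two hyperplanes

Layer `Literature/Analysis/SpecialFunctions`, namespace `Literature.Analysis.SpecialFunctions` (lane
`lit-hodgefound`, Layer A4, theta-divisor row A4-17; prover seat `lit-hodgefound-p23`, row «A4-17(k)»).
Sequel of `RiemannThetaBlockDiagonalSingular.lean` (the Leibniz rule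
`dϑ_Ω(z)(v) = ϑ₁(z₁) dϑ₂(z₂)(v₂) + ϑ₂(z₂) dϑ₁(z₁)(v₁)` for `Ω = Ω₁ ⊕ Ω₂` and the exact singular locus
`{ϑ = dϑ = 0} ⊇ {ϑ₁ = 0} × {ϑ₂ = 0}`), now at second order.

Sources followed (held texts, read at the quoted chunks).

* S. Grushevsky, R. Salvati Manni, *Jacobians with a vanishing theta-null in genus 4*, Israel J. Math.
  164 (2008) [held `paper:arxiv-math_0605160`]: p0005 "if a point `x = τε/2 + δ/2` of order two is a
  singular point in the theta divisor … (the first derivatives at zero of an even function are all zero),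
  the rank of the quadric defining the tangent cone at `x` is the rank of the matrix [of second derivatives
  `∂²θ/∂zᵢ∂zⱼ`]"; p0007 "It is known that `N_{g-2}` is the locus of reducible ppavs [el]. It is then clear
  that ppavs with reducible theta divisor are in `θ_null²` — in this case the tangent cone is a quadric that
  is the union of two hyperplanes."
* S. Grushevsky, *The Schottky problem* (MSRI Publ. 59, 2012), §5 [held `paper:arxiv-1009.0369` p0011]:
  `Θ = (Θ₁ × A₂) ∪ (A₁ × Θ₂)`, `Sing Θ ⊃ Θ₁ × Θ₂`; `θ_null^3 ⊂ θ_null^{g-1}` "for rank of the tangent cone".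

What is here (theorems only; no definition, no named fact, net debt `0`). Throughout `Ω = Ω₁ ⊕ Ω₂`
(`Matrix.fromBlocks`, re-indexed by `finSumFinEquiv`), `Im Ωᵢ ≥ cᵢ > 0`, and `z = (z₁, z₂)` is a point of
`{ϑ₁ = 0} × {ϑ₂ = 0}` (a point of `Θ₁ × Θ₂ ⊆ Sing Θ` on the universal cover).

* **`fderiv_fderiv_riemannTheta_blockDiag_apply_of_zero`** — the second differential:
  `D²ϑ_Ω(z)[u, v] = dϑ₁(z₁)(v₁) · dϑ₂(z₂)(u₂) + dϑ₂(z₂)(v₂) · dϑ₁(z₁)(u₁)`.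
* `fderiv_fderiv_riemannTheta_blockDiag_self_of_zero` — the quadric of the tangent cone
  `Q(v) = D²ϑ_Ω(z)[v, v] = 2 · dϑ₁(z₁)(v₁) · dϑ₂(z₂)(v₂)`, and
  **`fderiv_fderiv_riemannTheta_blockDiag_self_eq_zero_iff`** — `Q(v) = 0 ↔ dϑ₁(z₁)(v₁) = 0 ∨ dϑ₂(z₂)(v₂) = 0`:
  "the tangent cone is a quadric that is the union of two hyperplanes" (`{dϑ₁(z₁) ∘ pr₁ = 0} ∪ {dϑ₂(z₂) ∘ pr₂ = 0}`;
  hyperplanes when `zᵢ` are smooth points of `{ϑᵢ = 0}`, which is not asserted).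
* **`hessian_riemannTheta_blockDiag_eq_of_zero`** — the Hessian matrix `(∂ᵢ∂ⱼϑ_Ω(z))` is
  `β ⊗ α + α ⊗ β` (`Matrix.vecMulVec`) with `α = (∂ⱼϑ₁(z₁))_j` (extended by `0`), `β = (∂ⱼϑ₂(z₂))_j`, hence
  **`rank_hessian_riemannTheta_blockDiag_le_two`**: `rank (∂ᵢ∂ⱼϑ_Ω(z)) ≤ 2` — "ppavs with reducible theta
  divisor are in `θ_null²`" at the level of the defining function on the universal cover.

Not here: the descent of the Hessian rank to `Sing Θ ⊂ X_Ω` (at a point of `Sing Θ` the Hessian of `ϑ`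
changes by the non-vanishing automorphy factor only), `θ_null^k` as loci in `𝒜_g`, the converse
`θ_null² ∩ … ⊂ N_{g-2}`, the heat equation form of the Hessian (`RiemannThetaHeatEquation.lean`).

## References

* [GrushevskySalvatiManni2008] S. Grushevsky, R. Salvati Manni, Jacobians with a vanishing theta-null in
  genus 4, Israel J. Math. 164 (2008), 303–315 (arXiv:math/0605160), pp. 5, 7 of the held text.
* [Grushevsky2012SchottkyProblem] S. Grushevsky, The Schottky problem, MSRI Publ. 59 (2012), §5.
-/

noncomputable section

open Complex Real Filter Topology
open scoped Matrix

namespace Literature.Analysis.SpecialFunctions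

variable {n₁ n₂ : ℕ}

section Hessian

variable {Ω₁ : Matrix (Fin n₁) (Fin n₁) ℂ} {Ω₂ : Matrix (Fin n₂) (Fin n₂) ℂ}
  {Ω : Matrix (Fin (n₁ + n₂)) (Fin (n₁ + n₂)) ℂ}
  (hΩ : Ω = Matrix.reindex finSumFinEquiv finSumFinEquiv (Matrix.fromBlocks Ω₁ 0 0 Ω₂))
  {c₁ c₂ : ℝ} (hc₁ : 0 < c₁) (hc₂ : 0 < c₂)
  (hY₁ : ∀ x : Fin n₁ → ℝ, c₁ * ∑ i, x i ^ 2 ≤ ∑ i, ∑ j, x i * (Ω₁ i j).im * x j)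
  (hY₂ : ∀ x : Fin n₂ → ℝ, c₂ * ∑ i, x i ^ 2 ≤ ∑ i, ∑ j, x i * (Ω₂ i j).im * x j)

/-- The coordinate restriction `z ↦ z ∘ e` is a continuous linear map, hence its own derivative. [folklore] -/
private theorem hasFDerivAt_restrict' {k : ℕ} (e : Fin k → Fin (n₁ + n₂)) (z : Fin (n₁ + n₂) → ℂ) :
    HasFDerivAt (fun z : Fin (n₁ + n₂) → ℂ ↦ fun i ↦ z (e i))
      (LinearMap.toContinuousLinearMap (LinearMap.funLeft ℂ ℂ e)) z :=
  (LinearMap.toContinuousLinearMap (LinearMap.funLeft ℂ ℂ e)).hasFDerivAt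

include hΩ hc₁ hc₂ hY₁ hY₂ in
/-- **The second differential of `ϑ(·, Ω₁ ⊕ Ω₂)` at a point of `{ϑ₁ = 0} × {ϑ₂ = 0}`**:
`D²ϑ_Ω(z)[u, v] = dϑ₁(z₁)(v₁) · dϑ₂(z₂)(u₂) + dϑ₂(z₂)(v₂) · dϑ₁(z₁)(u₁)` for `z = (z₁, z₂)` with
`ϑ₁(z₁) = ϑ₂(z₂) = 0` — differentiate the Leibniz rule
`dϑ_Ω(w)(u) = ϑ₁(w₁) dϑ₂(w₂)(u₂) + ϑ₂(w₂) dϑ₁(w₁)(u₁)` once more and drop the two terms carrying the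
factors `ϑ₁(z₁) = 0`, `ϑ₂(z₂) = 0` (GSM: at a singular point of order two "the rank of the quadric defining
the tangent cone at `x` is the rank of the matrix" of second derivatives).
[cite: GrushevskySalvatiManni2008, p0005 and p0007 of the held text] [cite: Grushevsky2012SchottkyProblem, §5 (held p0011)] -/
theorem fderiv_fderiv_riemannTheta_blockDiag_apply_of_zero (z u v : Fin (n₁ + n₂) → ℂ)
    (h₁ : riemannTheta Ω₁ (fun i ↦ z (Fin.castAdd n₂ i)) = 0)
    (h₂ : riemannTheta Ω₂ (fun i ↦ z (Fin.natAdd n₁ i)) = 0) :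
    fderiv ℂ (fun w ↦ fderiv ℂ (riemannTheta Ω) w u) z v =
      fderiv ℂ (riemannTheta Ω₁) (fun i ↦ z (Fin.castAdd n₂ i)) (fun i ↦ v (Fin.castAdd n₂ i)) *
          fderiv ℂ (riemannTheta Ω₂) (fun i ↦ z (Fin.natAdd n₁ i)) (fun i ↦ u (Fin.natAdd n₁ i)) +
        fderiv ℂ (riemannTheta Ω₂) (fun i ↦ z (Fin.natAdd n₁ i)) (fun i ↦ v (Fin.natAdd n₁ i)) *
          fderiv ℂ (riemannTheta Ω₁) (fun i ↦ z (Fin.castAdd n₂ i)) (fun i ↦ u (Fin.castAdd n₂ i)) := by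
  -- the four factors of the Leibniz rule, as functions of `w`, and their derivatives at `z`
  have hf₁ : HasFDerivAt (fun w : Fin (n₁ + n₂) → ℂ ↦ riemannTheta Ω₁ (fun i ↦ w (Fin.castAdd n₂ i)))
      ((fderiv ℂ (riemannTheta Ω₁) (fun i ↦ z (Fin.castAdd n₂ i))).comp
        (LinearMap.toContinuousLinearMap (LinearMap.funLeft ℂ ℂ (Fin.castAdd n₂)))) z :=
    ((differentiable_riemannTheta Ω₁ hc₁ hY₁) _).hasFDerivAt.comp z (hasFDerivAt_restrict' _ z)
  have hf₂ : HasFDerivAt (fun w : Fin (n₁ + n₂) → ℂ ↦ riemannTheta Ω₂ (fun i ↦ w (Fin.natAdd n₁ i)))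
      ((fderiv ℂ (riemannTheta Ω₂) (fun i ↦ z (Fin.natAdd n₁ i))).comp
        (LinearMap.toContinuousLinearMap (LinearMap.funLeft ℂ ℂ (Fin.natAdd n₁)))) z :=
    ((differentiable_riemannTheta Ω₂ hc₂ hY₂) _).hasFDerivAt.comp z (hasFDerivAt_restrict' _ z)
  have hg₁ : DifferentiableAt ℂ (fun w : Fin (n₁ + n₂) → ℂ ↦
      fderiv ℂ (riemannTheta Ω₁) (fun i ↦ w (Fin.castAdd n₂ i)) (fun i ↦ u (Fin.castAdd n₂ i))) z := by
    have h := ((differentiable_fderiv_riemannTheta_apply Ω₁ hc₁ hY₁ (fun i ↦ u (Fin.castAdd n₂ i)))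
      _).hasFDerivAt.comp z (hasFDerivAt_restrict' (Fin.castAdd n₂) z)
    exact h.differentiableAt
  have hg₂ : DifferentiableAt ℂ (fun w : Fin (n₁ + n₂) → ℂ ↦
      fderiv ℂ (riemannTheta Ω₂) (fun i ↦ w (Fin.natAdd n₁ i)) (fun i ↦ u (Fin.natAdd n₁ i))) z := by
    have h := ((differentiable_fderiv_riemannTheta_apply Ω₂ hc₂ hY₂ (fun i ↦ u (Fin.natAdd n₁ i)))
      _).hasFDerivAt.comp z (hasFDerivAt_restrict' (Fin.natAdd n₁) z)
    exact h.differentiableAt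
  have hsum := (hf₁.mul hg₂.hasFDerivAt).add (hf₂.mul hg₁.hasFDerivAt)
  -- the Leibniz rule identifies `w ↦ dϑ_Ω(w)(u)` with the differentiated combination
  have key := hsum.congr_of_eventuallyEq (Filter.Eventually.of_forall fun w ↦ (by
    simp only [Pi.add_apply, Pi.mul_apply]
    exact fderiv_riemannTheta_blockDiag_apply hΩ hc₁ hc₂ hY₁ hY₂ w u))
  -- `funLeft e w = w ∘ e`, in the `fun`-form of the statement
  have hfl : ∀ {k : ℕ} (e : Fin k → Fin (n₁ + n₂)) (w : Fin (n₁ + n₂) → ℂ),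
      LinearMap.funLeft ℂ ℂ e w = fun i ↦ w (e i) := fun _ _ ↦ rfl
  rw [key.fderiv]
  simp only [_root_.add_apply, _root_.smul_apply, smul_eq_mul, h₁, h₂, zero_mul, zero_add,
    ContinuousLinearMap.comp_apply, LinearMap.coe_toContinuousLinearMap', hfl]
  ring

include hΩ hc₁ hc₂ hY₁ hY₂ in
/-- **The quadric of the tangent cone at a point of `Θ₁ × Θ₂`**: `Q(v) = D²ϑ_Ω(z)[v, v] = 2 dϑ₁(z₁)(v₁) dϑ₂(z₂)(v₂)`.
[cite: GrushevskySalvatiManni2008, p0007 of the held text] [cite: Grushevsky2012SchottkyProblem, §5 (held p0011)] -/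
theorem fderiv_fderiv_riemannTheta_blockDiag_self_of_zero (z v : Fin (n₁ + n₂) → ℂ)
    (h₁ : riemannTheta Ω₁ (fun i ↦ z (Fin.castAdd n₂ i)) = 0)
    (h₂ : riemannTheta Ω₂ (fun i ↦ z (Fin.natAdd n₁ i)) = 0) :
    fderiv ℂ (fun w ↦ fderiv ℂ (riemannTheta Ω) w v) z v =
      2 * fderiv ℂ (riemannTheta Ω₁) (fun i ↦ z (Fin.castAdd n₂ i)) (fun i ↦ v (Fin.castAdd n₂ i)) *
        fderiv ℂ (riemannTheta Ω₂) (fun i ↦ z (Fin.natAdd n₁ i)) (fun i ↦ v (Fin.natAdd n₁ i)) := by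
  rw [fderiv_fderiv_riemannTheta_blockDiag_apply_of_zero hΩ hc₁ hc₂ hY₁ hY₂ z v v h₁ h₂]
  ring

include hΩ hc₁ hc₂ hY₁ hY₂ in
/-- **"The tangent cone is a quadric that is the union of two hyperplanes"** (GSM): at a point
`z = (z₁, z₂)` of `{ϑ₁ = 0} × {ϑ₂ = 0}` the quadric `Q(v) = D²ϑ_Ω(z)[v, v]` vanishes iff
`dϑ₁(z₁)(v₁) = 0` or `dϑ₂(z₂)(v₂) = 0`, i.e. `{Q = 0} = {dϑ₁(z₁) ∘ pr₁ = 0} ∪ {dϑ₂(z₂) ∘ pr₂ = 0}`.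
[cite: GrushevskySalvatiManni2008, p0007 of the held text] [cite: Grushevsky2012SchottkyProblem, §5 (held p0011)] -/
theorem fderiv_fderiv_riemannTheta_blockDiag_self_eq_zero_iff (z v : Fin (n₁ + n₂) → ℂ)
    (h₁ : riemannTheta Ω₁ (fun i ↦ z (Fin.castAdd n₂ i)) = 0)
    (h₂ : riemannTheta Ω₂ (fun i ↦ z (Fin.natAdd n₁ i)) = 0) :
    fderiv ℂ (fun w ↦ fderiv ℂ (riemannTheta Ω) w v) z v = 0 ↔
      fderiv ℂ (riemannTheta Ω₁) (fun i ↦ z (Fin.castAdd n₂ i)) (fun i ↦ v (Fin.castAdd n₂ i)) = 0 ∨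
        fderiv ℂ (riemannTheta Ω₂) (fun i ↦ z (Fin.natAdd n₁ i)) (fun i ↦ v (Fin.natAdd n₁ i)) = 0 := by
  rw [fderiv_fderiv_riemannTheta_blockDiag_self_of_zero hΩ hc₁ hc₂ hY₁ hY₂ z v h₁ h₂, mul_assoc,
    mul_eq_zero, mul_eq_zero, or_iff_right (two_ne_zero (α := ℂ))]

include hΩ hc₁ hc₂ hY₁ hY₂ in
/-- **The Hessian matrix of `ϑ(·, Ω₁ ⊕ Ω₂)` at a point of `{ϑ₁ = 0} × {ϑ₂ = 0}` is the symmetrised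
outer product `β ⊗ α + α ⊗ β`** of the two (zero-extended) gradients `α = (∂ⱼϑ₁(z₁))_j`,
`β = (∂ⱼϑ₂(z₂))_j`: `∂ᵢ∂ⱼϑ_Ω(z) = βᵢ αⱼ + αᵢ βⱼ`.
[cite: GrushevskySalvatiManni2008, p0005 and p0007 of the held text] -/
theorem hessian_riemannTheta_blockDiag_eq_of_zero (z : Fin (n₁ + n₂) → ℂ)
    (h₁ : riemannTheta Ω₁ (fun i ↦ z (Fin.castAdd n₂ i)) = 0)
    (h₂ : riemannTheta Ω₂ (fun i ↦ z (Fin.natAdd n₁ i)) = 0) :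
    (Matrix.of fun i j : Fin (n₁ + n₂) ↦ fderiv ℂ (fun w ↦ fderiv ℂ (riemannTheta Ω) w
        (Pi.single i (1 : ℂ))) z (Pi.single j (1 : ℂ))) =
      Matrix.vecMulVec
          (fun i ↦ fderiv ℂ (riemannTheta Ω₂) (fun k ↦ z (Fin.natAdd n₁ k))
            (fun k ↦ (Pi.single i (1 : ℂ) : Fin (n₁ + n₂) → ℂ) (Fin.natAdd n₁ k)))
          (fun j ↦ fderiv ℂ (riemannTheta Ω₁) (fun k ↦ z (Fin.castAdd n₂ k))
            (fun k ↦ (Pi.single j (1 : ℂ) : Fin (n₁ + n₂) → ℂ) (Fin.castAdd n₂ k))) +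
        Matrix.vecMulVec
          (fun i ↦ fderiv ℂ (riemannTheta Ω₁) (fun k ↦ z (Fin.castAdd n₂ k))
            (fun k ↦ (Pi.single i (1 : ℂ) : Fin (n₁ + n₂) → ℂ) (Fin.castAdd n₂ k)))
          (fun j ↦ fderiv ℂ (riemannTheta Ω₂) (fun k ↦ z (Fin.natAdd n₁ k))
            (fun k ↦ (Pi.single j (1 : ℂ) : Fin (n₁ + n₂) → ℂ) (Fin.natAdd n₁ k))) := by
  ext i j
  rw [Matrix.of_apply, Matrix.add_apply, Matrix.vecMulVec_apply, Matrix.vecMulVec_apply,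
    fderiv_fderiv_riemannTheta_blockDiag_apply_of_zero hΩ hc₁ hc₂ hY₁ hY₂ z _ _ h₁ h₂]
  ring

/-- `rank (A + B) ≤ rank A + rank B` for complex matrices. [folklore] -/
private theorem rank_add_le_rank_add_rank {m : Type*} [Fintype m] (A B : Matrix m (Fin (n₁ + n₂)) ℂ) :
    (A + B).rank ≤ A.rank + B.rank := by
  unfold Matrix.rank
  rw [Matrix.mulVecLin_add]
  exact (Submodule.finrank_mono (LinearMap.range_add_le _ _)).trans
    (Submodule.finrank_add_le_finrank_add_finrank _ _)

include hΩ hc₁ hc₂ hY₁ hY₂ in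
/-- **"ppavs with reducible theta divisor are in `θ_null²`"** at the level of the defining function: at a
point of `{ϑ₁ = 0} × {ϑ₂ = 0}` the Hessian matrix `(∂ᵢ∂ⱼϑ_{Ω₁ ⊕ Ω₂}(z))` — whose rank is "the rank of the
quadric defining the tangent cone" — has rank at most `2`.
[cite: GrushevskySalvatiManni2008, p0005 and p0007 of the held text] [cite: Grushevsky2012SchottkyProblem, §5 (held p0011)] -/
theorem rank_hessian_riemannTheta_blockDiag_le_two (z : Fin (n₁ + n₂) → ℂ)
    (h₁ : riemannTheta Ω₁ (fun i ↦ z (Fin.castAdd n₂ i)) = 0)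
    (h₂ : riemannTheta Ω₂ (fun i ↦ z (Fin.natAdd n₁ i)) = 0) :
    (Matrix.of fun i j : Fin (n₁ + n₂) ↦ fderiv ℂ (fun w ↦ fderiv ℂ (riemannTheta Ω) w
        (Pi.single i (1 : ℂ))) z (Pi.single j (1 : ℂ))).rank ≤ 2 := by
  rw [hessian_riemannTheta_blockDiag_eq_of_zero hΩ hc₁ hc₂ hY₁ hY₂ z h₁ h₂]
  refine (rank_add_le_rank_add_rank _ _).trans ?_
  have ha := Matrix.rank_vecMulVec_le
    (fun i : Fin (n₁ + n₂) ↦ fderiv ℂ (riemannTheta Ω₂) (fun k ↦ z (Fin.natAdd n₁ k))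
      (fun k ↦ (Pi.single i (1 : ℂ) : Fin (n₁ + n₂) → ℂ) (Fin.natAdd n₁ k)))
    (fun j : Fin (n₁ + n₂) ↦ fderiv ℂ (riemannTheta Ω₁) (fun k ↦ z (Fin.castAdd n₂ k))
      (fun k ↦ (Pi.single j (1 : ℂ) : Fin (n₁ + n₂) → ℂ) (Fin.castAdd n₂ k)))
  have hb := Matrix.rank_vecMulVec_le
    (fun i : Fin (n₁ + n₂) ↦ fderiv ℂ (riemannTheta Ω₁) (fun k ↦ z (Fin.castAdd n₂ k))
      (fun k ↦ (Pi.single i (1 : ℂ) : Fin (n₁ + n₂) → ℂ) (Fin.castAdd n₂ k)))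
    (fun j : Fin (n₁ + n₂) ↦ fderiv ℂ (riemannTheta Ω₂) (fun k ↦ z (Fin.natAdd n₁ k))
      (fun k ↦ (Pi.single j (1 : ℂ) : Fin (n₁ + n₂) → ℂ) (Fin.natAdd n₁ k)))
  omega

end Hessian

end Literature.Analysis.SpecialFunctions

end
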